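import Summits.NavierStokesRegularity.NavierStokesRegularity.Theorems.ClockStretchingLawClockCeilingIffTarget
import Summits.NavierStokesRegularity.NavierStokesRegularity.Theorems.ClockStretchingLawClockCeilingLerayFloor
import Summits.NavierStokesRegularity.NavierStokesRegularity.Theorems.ClockStretchingLawClockCeilingLocalisedLerayFloor
import Summits.NavierStokesRegularity.NavierStokesRegularity.Theorems.ClockStretchingLawClockCeilingBackwardL3Blowup
import Summits.NavierStokesRegularity.NavierStokesRegularity.Theorems.ClockStretchingLawClockCeilingCompactVorticityLiouville
import Summits.NavierStokesRegularity.NavierStokesRegularity.Theorems.ClockStretchingLawClockCeilingOpenSetVorticityLiouville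
import Summits.NavierStokesRegularity.NavierStokesRegularity.Theorems.ClockStretchingLawClockCeilingOpenSetSteadyLiouville
import Summits.NavierStokesRegularity.NavierStokesRegularity.Theorems.ClockStretchingLawClockCeilingFarPastVorticityFloor
import Summits.NavierStokesRegularity.NavierStokesRegularity.Theorems.ClockStretchingLawClockCeilingFarPastClockFloor
import Summits.NavierStokesRegularity.NavierStokesRegularity.Theorems.ClockStretchingLawClockCeilingGaussianEnstrophyFloor
import HarnessLib

/-!
# Route ClockStretchingLaw, crux `ClockCeiling` (stmt-NavierStokesRegularity-10570) — PORTRAIT II of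
# a counterexample (lead c6 kill list)

Capstone glue of the lead-c6 clauses (p162493 p163157 p164211 p162477 p164176 p163408 p163399 p164452
p164179 p164186 p162719) on top of `clockCeiling_iff_singular` (p152790): if the crux fails, one
singular element `u` of the Type-I class `𝒦_C` carries SIMULTANEOUSLY the universal Leray floor
at every time (and inside the backward paraboloid), the far-past amplitude floor, backward `L³`
blow-up, vorticity of unbounded support with no open zero set on every slice, no locally steady and
no locally vanishing slice, the far-past vorticity and recentred-clock floors, and the Gaussian
enstrophy floor at every time. Companion of `not_clockCeiling_portrait` (p160434, lead c5: clock,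
frame, localised vorticity floors and the stretching rungs).

## References

* G. Koch, N. Nadirashvili, G. Seregin, V. Šverák, Acta Math. 203 (2009) = arXiv:0709.3599.
  [KochNadirashviliSereginSverak2009]
* D. Albritton, T. Barker, arXiv:1811.00502, Thm 1.2. [AlbrittonBarker2019]
* L. Escauriaza, G. Seregin, V. Šverák, Russ. Math. Surveys 58 (2003). [EscauriazaSereginSverak2003]
-/

noncomputable section

-- the summit and its single sub-problem share the name (CONVENTIONS §1), as in every Theorems file
set_option linter.dupNamespace false

open MeasureTheory Set Filter Topology
open scoped ENNReal
open Literature.Analysis Literature.Analysis.FluidPDE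
open Summit.NavierStokesRegularity.NavierStokesRegularity.Theses.ClockStretchingLaw

namespace Summit.NavierStokesRegularity.NavierStokesRegularity.Theorems

/-- **Portrait II of a counterexample to `ClockCeiling` (lead c6 kill list).** If the crux fails,
some singular element `u ∈ 𝒦_C` carries, simultaneously: (a) the universal Leray floor
`√(−t) sup‖u(t)‖ > 1/(32C₀)` at every `t < 0`, (b) attained inside the paraboloid `‖x‖ < R√(−t)`,
(c) the far-past amplitude floor, (d) `‖u(t)‖_{L³} → ∞` as `t → −∞`, (e) vorticity of unbounded
support on every slice, (f)/(g)/(h) no open set of any slice on which the vorticity / the time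
derivative / the velocity vanishes, (i) the far-past vorticity floor, (j) the far-past recentred
clock floor, (k) the Gaussian enstrophy floor at every time. [folklore] -/
theorem not_clockCeiling_portraitII (hneg : ¬ ClockCeiling) :
    ∃ (C : ℝ) (u : ℝ → EuclideanSpace ℝ (Fin 3) → EuclideanSpace ℝ (Fin 3)),
      IsTypeIAncientMild C u ∧
      (∀ (x₀ : EuclideanSpace ℝ (Fin 3)) (t₀ r : ℝ), t₀ ≤ 0 → 0 < r →
        (∀ t, t₀ - r ^ 2 < t → t < t₀ → r⁻¹ * ∫ x in Metric.ball x₀ r, ‖u t x‖ ^ 2 ≤ C) ∧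
          r⁻¹ * ∫ t in Set.Ioo (t₀ - r ^ 2) t₀, ∫ x in Metric.ball x₀ r, ‖fderiv ℝ (u t) x‖ ^ 2 ≤ C) ∧
      -- singular at the space–time origin
      (∀ r > 0, ∀ M : ℝ, ∃ t ∈ Set.Ioo (-(r ^ 2)) (0 : ℝ),
        ∃ x ∈ Metric.ball (0 : EuclideanSpace ℝ (Fin 3)) r, M < ‖u t x‖) ∧
      -- (a) universal Leray floor at every time
      (∀ t < 0, ∃ x, 1 < 32 * oseenSliceConst (EuclideanSpace ℝ (Fin 3)) * (Real.sqrt (-t) * ‖u t x‖)) ∧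
      -- (b) … attained inside the backward paraboloid
      (∃ R > 0, ∀ t < 0, ∃ x ∈ Metric.ball (0 : EuclideanSpace ℝ (Fin 3)) (R * Real.sqrt (-t)),
        1 < 32 * oseenSliceConst (EuclideanSpace ℝ (Fin 3)) * (Real.sqrt (-t) * ‖u t x‖)) ∧
      -- (c) far-past amplitude floor
      (∃ T < 0, ∀ t < T, ∃ x,
        1 < 32 * oseenSliceConst (EuclideanSpace ℝ (Fin 3)) * (Real.sqrt (-t) * ‖u t x‖)) ∧
      -- (d) backward L³ blow-up
      (∀ M : ℝ, ∃ T < 0, ∀ t < T, ENNReal.ofReal M < eLpNorm (u t) 3 volume) ∧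
      -- (e) vorticity of unbounded support on every slice
      (∀ t₀ < 0, ∀ R : ℝ, ∃ x, R < ‖x‖ ∧ curl (u t₀) x ≠ 0) ∧
      -- (f) no open zero set of the vorticity on any slice
      (∀ t₀ < 0, ∀ U : Set (EuclideanSpace ℝ (Fin 3)), IsOpen U → U.Nonempty →
        ∃ x ∈ U, curl (u t₀) x ≠ 0) ∧
      -- (g) no locally steady slice
      (∀ t₀ < 0, ∀ U : Set (EuclideanSpace ℝ (Fin 3)), IsOpen U → U.Nonempty →
        ∃ x ∈ U, timeDeriv u t₀ x ≠ 0) ∧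
      -- (h) no locally vanishing slice
      (∀ t₀ < 0, ∀ U : Set (EuclideanSpace ℝ (Fin 3)), IsOpen U → U.Nonempty →
        ∃ x ∈ U, u t₀ x ≠ 0) ∧
      -- (i) far-past vorticity floor
      (∃ η > 0, ∃ T < 0, ∀ t < T, ∃ x, η ≤ (-t) * ‖curl (u t) x‖) ∧
      -- (j) far-past recentred clock floor
      (∃ δ > 0, ∃ T < 0, ∀ t < T, ∃ x₀ : EuclideanSpace ℝ (Fin 3), δ ≤ (-t) ^ ((3 : ℝ) / 2) *
        ∫ x, ‖timeDeriv u t x‖ ^ 2 * Real.exp (-(‖x - x₀‖ ^ 2) / (4 * (-t)))) ∧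
      -- (k) Gaussian enstrophy floor at every time
      (∃ η > 0, ∀ t < 0, η ≤ Real.sqrt (-t) *
        ∫ x, ‖curl (u t) x‖ ^ 2 * Real.exp (-(‖x‖ ^ 2) / (4 * (-t)))) := by
  -- a singular element violating the ceiling
  rw [clockCeiling_iff_singular] at hneg
  push Not at hneg
  obtain ⟨C, u, hu, hE, hsing, -⟩ := hneg
  have hne : ∃ t < 0, ∃ x, u t x ≠ 0 := by
    obtain ⟨t, ht, x, -, hM⟩ := hsing 1 one_pos 0
    exact ⟨t, ht.2, x, fun h0 => by rw [h0, norm_zero] at hM; exact lt_irrefl _ hM⟩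
  have hne' : ¬ ∀ t < 0, ∀ x, u t x = 0 := by
    intro h0
    obtain ⟨t, ht, x, hx⟩ := hne
    exact hx (h0 t ht x)
  refine ⟨C, u, hu, hE, hsing, ?_, ?_, ?_, ?_, ?_, ?_, ?_, ?_, ?_, ?_, ?_⟩
  · -- (a)
    exact stub_lerayFloorSingular C u hu hsing
  · -- (b)
    obtain ⟨R, hR, hloc⟩ := stub_localisedLerayFloor C
    exact ⟨R, hR, fun t ht => hloc u hu hE hsing t ht⟩
  · -- (c)
    exact farPastAmplitudeFloor hu hne
  · -- (d)
    exact stub_backwardL3Blowup C u hu hne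
  · -- (e)
    intro t₀ ht₀ R
    exact curl_support_unbounded_of_ne_zero hu hne ht₀ R
  · -- (f)
    intro t₀ ht₀ U hU hUne
    by_contra hcon
    push Not at hcon
    exact hne' (stub_openSetVorticityLiouville C u hu t₀ U ht₀ hU hUne hcon)
  · -- (g)
    intro t₀ ht₀ U hU hUne
    by_contra hcon
    push Not at hcon
    exact hne' (stub_openSetSteadyLiouville C u hu t₀ U ht₀ hU hUne hcon)
  · -- (h)
    intro t₀ ht₀ U hU hUne
    by_contra hcon
    push Not at hcon
    exact hne' (openSetVelocityLiouville hu ht₀ hU hUne hcon)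
  · -- (i)
    obtain ⟨η, hη, hfloor⟩ := stub_farPastVorticityFloor C
    exact ⟨η, hη, hfloor u hu hne⟩
  · -- (j)
    obtain ⟨δ, hδ, hfloor⟩ := stub_farPastClockFloor C
    exact ⟨δ, hδ, hfloor u hu hne⟩
  · -- (k)
    obtain ⟨η, hη, hfloor⟩ := stub_gaussianEnstrophyFloor C
    exact ⟨η, hη, fun t ht => hfloor u hu hE hsing t ht⟩

/-- **Stub `stub_counterexamplePortraitII` (crux stmt-NavierStokesRegularity-10570, line `registered`):
the lead-c6 kill list `not_clockCeiling_portraitII` with fully qualified names.** [folklore] -/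
theorem stub_counterexamplePortraitII : ¬ Summit.NavierStokesRegularity.NavierStokesRegularity.Theses.ClockStretchingLaw.ClockCeiling → ∃ (C : ℝ) (u : ℝ → EuclideanSpace ℝ (Fin 3) → EuclideanSpace ℝ (Fin 3)), Literature.Analysis.FluidPDE.IsTypeIAncientMild C u ∧ (∀ (x₀ : EuclideanSpace ℝ (Fin 3)) (t₀ r : ℝ), t₀ ≤ 0 → 0 < r → (∀ t, t₀ - r ^ 2 < t → t < t₀ → r⁻¹ * ∫ x in Metric.ball x₀ r, ‖u t x‖ ^ 2 ≤ C) ∧ r⁻¹ * ∫ t in Set.Ioo (t₀ - r ^ 2) t₀, ∫ x in Metric.ball x₀ r, ‖fderiv ℝ (u t) x‖ ^ 2 ≤ C) ∧ (∀ r > 0, ∀ M : ℝ, ∃ t ∈ Set.Ioo (-(r ^ 2)) (0 : ℝ), ∃ x ∈ Metric.ball (0 : EuclideanSpace ℝ (Fin 3)) r, M < ‖u t x‖) ∧ (∀ t < 0, ∃ x, 1 < 32 * Literature.Analysis.FluidPDE.oseenSliceConst (EuclideanSpace ℝ (Fin 3)) * (Real.sqrt (-t) * ‖u t x‖)) ∧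 (∃ R > 0, ∀ t < 0, ∃ x ∈ Metric.ball (0 : EuclideanSpace ℝ (Fin 3)) (R * Real.sqrt (-t)), 1 < 32 * Literature.Analysis.FluidPDE.oseenSliceConst (EuclideanSpace ℝ (Fin 3)) * (Real.sqrt (-t) * ‖u t x‖)) ∧ (∃ T < 0, ∀ t < T, ∃ x, 1 < 32 * Literature.Analysis.FluidPDE.oseenSliceConst (EuclideanSpace ℝ (Fin 3)) * (Real.sqrt (-t) * ‖u t x‖)) ∧ (∀ M : ℝ, ∃ T < 0, ∀ t < T, ENNReal.ofReal M < MeasureTheory.eLpNorm (u t) 3 MeasureTheory.volume) ∧ (∀ t₀ < 0, ∀ R : ℝ, ∃ x, R < ‖x‖ ∧ Literature.Analysis.FluidPDE.curl (u t₀) x ≠ 0) ∧ (∀ t₀ < 0, ∀ U : Set (EuclideanSpace ℝ (Fin 3)), IsOpen U → U.Nonempty → ∃ x ∈ U, Literature.Analysis.FluidPDE.curl (u t₀) x ≠ 0) ∧ (∀ t₀ < 0, ∀ U : Set (EuclideanSpace ℝ (Fin 3)), IsOpen U → U.Nonempty → ∃ x ∈ U, Literature.Analysis.FluidPDE.timeDeriv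 u t₀ x ≠ 0) ∧ (∀ t₀ < 0, ∀ U : Set (EuclideanSpace ℝ (Fin 3)), IsOpen U → U.Nonempty → ∃ x ∈ U, u t₀ x ≠ 0) ∧ (∃ η > 0, ∃ T < 0, ∀ t < T, ∃ x, η ≤ (-t) * ‖Literature.Analysis.FluidPDE.curl (u t) x‖) ∧ (∃ δ > 0, ∃ T < 0, ∀ t < T, ∃ x₀ : EuclideanSpace ℝ (Fin 3), δ ≤ (-t) ^ ((3 : ℝ) / 2) * ∫ x, ‖Literature.Analysis.FluidPDE.timeDeriv u t x‖ ^ 2 * Real.exp (-(‖x - x₀‖ ^ 2) / (4 * (-t)))) ∧ (∃ η > 0, ∀ t < 0, η ≤ Real.sqrt (-t) * ∫ x, ‖Literature.Analysis.FluidPDE.curl (u t) x‖ ^ 2 * Real.exp (-(‖x‖ ^ 2) / (4 * (-t)))) :=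
  fun hneg => not_clockCeiling_portraitII hneg

end Summit.NavierStokesRegularity.NavierStokesRegularity.Theorems

end
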